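import Mathlib
import Summits.NavierStokesRegularity.NavierStokesRegularity.Theorems.EulerZoomLiouvillePowerGaugeEulerLiouvilleMeanStrainTools
import HarnessLib

/-!
# Crux `EulerZoomLiouville.PowerGaugeEulerLiouville` (stmt-NavierStokesRegularity-19832): the escaping trajectory (per-label half of plate t59-ESC, nsreg-p2 ROUND-54)

Width/portrait helper for THE ONE STATEMENT `stub_selfSimilarC2Needle` (LEAD skeleton `Cruxes/PowerGaugeEulerLiouville/Lines/birth.lean` v111,
ns-typeII-p2 g16), `--supports stmt-NavierStokesRegularity-19832 --as helper`.  Text custody nsreg-p2 g44 (`r54/Sketch54.lean` f78682d2f4ee3f27,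
`NsregP2.R54.Trace.ForwardEscapeLaw`, memo §3 bullet 1 / §8 t59-ESC).  In the lineage's cut-off idiom (`V ∈ C²`, `‖DV‖ ≤ K`, flow
`Ψ_s = ODE.evolutionMap (fun _ => selfSimilarTransport γ 0 V) 0 s` of `W = γy + V`):

* `hasDerivAt_physicalPosition` — the PHYSICAL position `x(s) = e^{−γs}Ψ_s y` moves with velocity `e^{−γs}V(Ψ_s y)` (the `γy` drift cancels);
* `exists_crossing_times` — if `‖y‖ ≤ CL/2` and the physical radius reaches `CL` before the horizon `S`, there are a LAST ENTRY time `s₁` and a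
  FIRST EXIT time `s₂`, `0 ≤ s₁ < s₂ ≤ S`, with the orbit inside the `CL`-tube on `[0, s₂]`, physical radius `≤ CL/2` at `s₁` and `≥ CL` at `s₂`
  (`sSup`/`sInf` of closed sets + continuity of the orbit);
* `sq_le_lintegral_escape` — hence `(CL/2)² ≤ ∫_{[0,S]} 𝟙{orbit in the tube on [0,s]} e^{(1−2γ)s}‖V(Ψ_s y)‖² ds`: the displacement `CL/2` is at most
  `∫_{s₁}^{s₂} e^{−γs}‖V(Ψ_s y)‖ ds` (FTC), and Cauchy–Schwarz in time with the weights `e^{−s}·e^{(1−2γ)s}` (`∫_{s₁}^{s₂} e^{−s} ≤ 1`).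

HONEST FRAMING: kinematics of HYPOTHETICAL profiles' cut-off flows; nothing about the crux E (19832 OPEN) or NS regularity is proved here.
[nsreg-p2 R54 §C t59-ESC; cite: ConstantinIgnatovaVicol2026Putative, §3.4.1 eq. (3.21)]
-/

noncomputable section

set_option linter.dupNamespace false

open MeasureTheory Set Filter Topology Metric Function
open scoped RealInnerProductSpace NNReal ENNReal ContDiff

namespace Summit.NavierStokesRegularity.NavierStokesRegularity.Theorems.PowerGaugeEulerLiouville.Trace

open Literature.Analysis Literature.Analysis.FluidPDE
open Summit.NavierStokesRegularity.NavierStokesRegularity.Theorems.PowerGaugeEulerLiouville.BernoulliLandscape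
open Summit.NavierStokesRegularity.NavierStokesRegularity.Theorems.PowerGaugeEulerLiouville.NeedleFeeding

variable {γ : ℝ} {V : EuclideanSpace ℝ (Fin 3) → EuclideanSpace ℝ (Fin 3)} {K : ℝ}

/-! ### The physical position along the similarity flow -/

/-- **Physical velocity**: `d/ds (e^{−γs}Ψ_s y) = e^{−γs} V(Ψ_s y)` — the drift `γy` of `W = γy + V` cancels against the rescaling.
[cite: ConstantinIgnatovaVicol2026Putative, §3.4.1 eq. (3.21)] -/
theorem hasDerivAt_physicalPosition (hV : ContDiff ℝ 2 V) (hK : ∀ y, ‖fderiv ℝ V y‖ ≤ K)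
    (y : EuclideanSpace ℝ (Fin 3)) (s : ℝ) :
    HasDerivAt (fun r : ℝ => Real.exp (-γ * r) • ODE.evolutionMap (fun _ : ℝ => selfSimilarTransport γ 0 V) 0 r y)
      (Real.exp (-γ * s) • V (ODE.evolutionMap (fun _ : ℝ => selfSimilarTransport γ 0 V) 0 s y)) s := by
  have hV1 : ContDiff ℝ 1 V := hV.of_le (by norm_num)
  have h1 : HasDerivAt (fun r : ℝ => Real.exp (-γ * r)) (Real.exp (-γ * s) * -γ) s := by
    have h := ((hasDerivAt_id s).const_mul (-γ)).exp
    simpa only [id, mul_one] using h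
  have h2 := C2.Kelvin.hasDerivAt_flow (γ := γ) hV1 hK s y
  have h := h1.smul h2
  refine h.congr_deriv ?_
  simp only [selfSimilarTransport, sub_zero, smul_add, smul_smul]
  module

/-- The physical radius `s ↦ e^{−γs}‖Ψ_s y‖` is continuous. [folklore] -/
theorem continuous_physicalRadius (hV : ContDiff ℝ 2 V) (hK : ∀ y, ‖fderiv ℝ V y‖ ≤ K) (y : EuclideanSpace ℝ (Fin 3)) :
    Continuous fun s : ℝ => Real.exp (-γ * s) * ‖ODE.evolutionMap (fun _ : ℝ => selfSimilarTransport γ 0 V) 0 s y‖ :=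
  (by fun_prop : Continuous fun s : ℝ => Real.exp (-γ * s)).mul (continuous_flow_time (γ := γ) hV hK y).norm

/-! ### Last entry / first exit through the physical annulus `(CL/2, CL)` -/

/-- **Crossing times.**  If `‖y‖ ≤ D/2` (`D > 0`) and the physical radius `e^{−γs}‖Ψ_s y‖` reaches `D` at some `s ∈ [0, S]`, then there are
`0 ≤ s₁ < s₂ ≤ S` with: the radius is `≤ D` on `[0, s₂]`, `≥ D` at `s₂`, `≤ D/2` at `s₁`, and `> D/2` on `(s₁, s₂]`
(`s₂` = first exit = `sInf`, `s₁` = last entry before it = `sSup`; continuity of the orbit). [folklore] -/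
theorem exists_crossing_times (hV : ContDiff ℝ 2 V) (hK : ∀ y, ‖fderiv ℝ V y‖ ≤ K) {D S : ℝ} (hD : 0 < D)
    {y : EuclideanSpace ℝ (Fin 3)} (hy : ‖y‖ ≤ D / 2)
    (hesc : ∃ s ∈ Icc 0 S, D ≤ Real.exp (-γ * s) * ‖ODE.evolutionMap (fun _ : ℝ => selfSimilarTransport γ 0 V) 0 s y‖) :
    ∃ s₁ s₂ : ℝ, 0 ≤ s₁ ∧ s₁ < s₂ ∧ s₂ ≤ S ∧
      (∀ s ∈ Icc 0 s₂, Real.exp (-γ * s) * ‖ODE.evolutionMap (fun _ : ℝ => selfSimilarTransport γ 0 V) 0 s y‖ ≤ D) ∧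
      D ≤ Real.exp (-γ * s₂) * ‖ODE.evolutionMap (fun _ : ℝ => selfSimilarTransport γ 0 V) 0 s₂ y‖ ∧
      Real.exp (-γ * s₁) * ‖ODE.evolutionMap (fun _ : ℝ => selfSimilarTransport γ 0 V) 0 s₁ y‖ ≤ D / 2 ∧
      (∀ s ∈ Ioc s₁ s₂, D / 2 < Real.exp (-γ * s) * ‖ODE.evolutionMap (fun _ : ℝ => selfSimilarTransport γ 0 V) 0 s y‖) := by
  obtain ⟨g, hg⟩ : ∃ g : ℝ → ℝ, g = fun s => Real.exp (-γ * s) *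
      ‖ODE.evolutionMap (fun _ : ℝ => selfSimilarTransport γ 0 V) 0 s y‖ := ⟨_, rfl⟩
  have hgc : Continuous g := hg ▸ continuous_physicalRadius (γ := γ) hV hK y
  have hg0 : g 0 = ‖y‖ := by rw [hg]; simp [ODE.evolutionMap_self]
  -- first exit
  obtain ⟨A, hA⟩ : ∃ A : Set ℝ, A = {s | s ∈ Icc 0 S ∧ D ≤ g s} := ⟨_, rfl⟩
  have hAc : IsClosed A := hA ▸ isClosed_Icc.inter (isClosed_le continuous_const hgc)
  have hAne : A.Nonempty := by
    obtain ⟨s, hs, hsD⟩ := hesc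
    exact ⟨s, hA ▸ ⟨hs, by rw [hg]; exact hsD⟩⟩
  have hAbdd : BddBelow A := ⟨0, fun s hs => (hA ▸ hs).1.1⟩
  set s₂ := sInf A with hs₂
  have hs₂A : s₂ ∈ A := hAc.csInf_mem hAne hAbdd
  have hs₂' := hA ▸ hs₂A
  have hlt₂ : ∀ s, 0 ≤ s → s < s₂ → g s < D := by
    intro s hs0 hss
    by_contra h
    push Not at h
    have hsA : s ∈ A := hA ▸ ⟨⟨hs0, hss.le.trans hs₂'.1.2⟩, h⟩
    exact absurd (csInf_le hAbdd hsA) (not_le.2 hss)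
  have hs₂pos : 0 < s₂ := by
    rcases eq_or_lt_of_le hs₂'.1.1 with h0 | h0
    · exfalso
      have h := hs₂'.2
      rw [← h0, hg0] at h
      linarith
    · exact h0
  -- the radius is `≤ D` on `[0, s₂]` (closure of `[0, s₂)`)
  have hle₂ : ∀ s ∈ Icc 0 s₂, g s ≤ D := by
    have hZ : IsClosed {s : ℝ | g s ≤ D} := isClosed_le hgc continuous_const
    have hsub : Ico 0 s₂ ⊆ {s : ℝ | g s ≤ D} := fun s hs => (hlt₂ s hs.1 hs.2).le
    have hcl : closure (Ico 0 s₂) ⊆ {s : ℝ | g s ≤ D} := hZ.closure_subset_iff.2 hsub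
    rw [closure_Ico hs₂pos.ne] at hcl
    exact fun s hs => hcl hs
  -- last entry before `s₂`
  obtain ⟨B, hB⟩ : ∃ B : Set ℝ, B = {s | s ∈ Icc 0 s₂ ∧ g s ≤ D / 2} := ⟨_, rfl⟩
  have hBc : IsClosed B := hB ▸ isClosed_Icc.inter (isClosed_le hgc continuous_const)
  have h0B : (0 : ℝ) ∈ B := hB ▸ ⟨⟨le_rfl, hs₂pos.le⟩, by rw [hg0]; exact hy⟩
  have hBne : B.Nonempty := ⟨0, h0B⟩
  have hBbdd : BddAbove B := ⟨s₂, fun s hs => (hB ▸ hs).1.2⟩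
  set s₁ := sSup B with hs₁
  have hs₁B : s₁ ∈ B := hBc.csSup_mem hBne hBbdd
  have hs₁' := hB ▸ hs₁B
  have hgt₁ : ∀ s ∈ Ioc s₁ s₂, D / 2 < g s := by
    intro s hs
    by_contra h
    push Not at h
    have hsB : s ∈ B := hB ▸ ⟨⟨hs₁'.1.1.trans hs.1.le, hs.2⟩, h⟩
    exact absurd (le_csSup hBbdd hsB) (not_le.2 hs.1)
  have hs₁s₂ : s₁ < s₂ := by
    rcases eq_or_lt_of_le hs₁'.1.2 with h | h
    · exfalso
      have h1 := hs₁'.2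
      have h2 := hs₂'.2
      rw [h] at h1
      linarith
    · exact h
  refine ⟨s₁, s₂, hs₁'.1.1, hs₁s₂, hs₂'.1.2, ?_, ?_, ?_, ?_⟩
  · intro s hs; have := hle₂ s hs; rw [hg] at this; exact this
  · have := hs₂'.2; rw [hg] at this; exact this
  · have := hs₁'.2; rw [hg] at this; exact this
  · intro s hs; have := hgt₁ s hs; rw [hg] at this; exact this

/-! ### The escaping trajectory pays `(CL/2)²` of weighted kinetic time-integral -/

/-- `∫_{(s₁, s₂]} e^{−s} ds ≤ 1` for `0 ≤ s₁` (in `ℝ≥0∞`). [folklore] -/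
theorem lintegral_exp_neg_Ioc_le_one {s₁ s₂ : ℝ} (hs₁ : 0 ≤ s₁) (h12 : s₁ ≤ s₂) :
    ∫⁻ s in Ioc s₁ s₂, ENNReal.ofReal (Real.exp (-s)) ≤ 1 := by
  have hc : Continuous fun s : ℝ => Real.exp (-s) := by fun_prop
  have hint : IntegrableOn (fun s : ℝ => Real.exp (-s)) (Ioc s₁ s₂) volume :=
    (hc.continuousOn.integrableOn_compact isCompact_Icc).mono_set Ioc_subset_Icc_self
  rw [← ofReal_integral_eq_lintegral_ofReal hint (ae_of_all _ fun s => (Real.exp_pos _).le), ← ENNReal.ofReal_one]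
  refine ENNReal.ofReal_le_ofReal ?_
  rw [← intervalIntegral.integral_of_le h12]
  have hderiv : ∀ x ∈ uIcc s₁ s₂, HasDerivAt (fun s : ℝ => -Real.exp (-s)) (Real.exp (-x)) x := by
    intro x _
    have h := ((hasDerivAt_neg x).exp).neg
    refine h.congr_deriv ?_
    ring
  rw [intervalIntegral.integral_eq_sub_of_hasDerivAt hderiv (hc.intervalIntegrable s₁ s₂)]
  have h1 : Real.exp (-s₁) ≤ 1 := by rw [Real.exp_le_one_iff]; linarith
  have h2 : 0 < Real.exp (-s₂) := Real.exp_pos _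
  linarith

/-- **The escaping trajectory.**  If `‖y‖ ≤ D/2` and the physical radius reaches `D > 0` before the horizon `S`, then
`(D/2)² ≤ ∫_{[0,S]} 𝟙{∀σ″∈[0,s]: e^{−γσ″}‖Ψ_{σ″}y‖ ≤ D} · e^{(1−2γ)s}‖V(Ψ_s y)‖² ds` (in `ℝ≥0∞`): the displacement through the annulus is
`D/2 ≤ ∫_{s₁}^{s₂} e^{−γs}‖V(Ψ_s y)‖ds` (FTC for the physical position) and Cauchy–Schwarz in time with `∫_{s₁}^{s₂} e^{−s} ≤ 1`.
[nsreg-p2 R54 §C t59-ESC; cite: ConstantinIgnatovaVicol2026Putative, §3.4.1 eq. (3.21)] -/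
theorem sq_le_lintegral_escape (hV : ContDiff ℝ 2 V) (hK : ∀ y, ‖fderiv ℝ V y‖ ≤ K) {D S : ℝ} (hD : 0 < D)
    {y : EuclideanSpace ℝ (Fin 3)} (hy : ‖y‖ ≤ D / 2)
    (hesc : ∃ s ∈ Icc 0 S, D * Real.exp (γ * s) ≤ ‖ODE.evolutionMap (fun _ : ℝ => selfSimilarTransport γ 0 V) 0 s y‖) :
    ENNReal.ofReal ((D / 2) ^ 2) ≤ ∫⁻ s in Icc 0 S,
      indicator {s' : ℝ | ∀ σ ∈ Icc 0 s',
          ‖ODE.evolutionMap (fun _ : ℝ => selfSimilarTransport γ 0 V) 0 σ y‖ ≤ D * Real.exp (γ * σ)}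
        (fun s' => ENNReal.ofReal (Real.exp ((1 - 2 * γ) * s')) *
          ‖V (ODE.evolutionMap (fun _ : ℝ => selfSimilarTransport γ 0 V) 0 s' y)‖ₑ ^ 2) s := by
  obtain ⟨Φ, hΦ⟩ : ∃ Φ : ℝ → EuclideanSpace ℝ (Fin 3) → EuclideanSpace ℝ (Fin 3),
      Φ = ODE.evolutionMap (fun _ : ℝ => selfSimilarTransport γ (0 : EuclideanSpace ℝ (Fin 3)) V) 0 := ⟨_, rfl⟩
  -- physical-radius currency: `D e^{γs} ≤ ‖Ψ_s y‖ ↔ D ≤ e^{−γs}‖Ψ_s y‖`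
  have hconv : ∀ (s : ℝ) (z : EuclideanSpace ℝ (Fin 3)), D * Real.exp (γ * s) ≤ ‖z‖ ↔ D ≤ Real.exp (-γ * s) * ‖z‖ := by
    intro s z
    have hpos : 0 < Real.exp (γ * s) := Real.exp_pos _
    have e : Real.exp (-γ * s) * ‖z‖ = ‖z‖ / Real.exp (γ * s) := by
      rw [show -γ * s = -(γ * s) by ring, Real.exp_neg, div_eq_inv_mul]
    rw [e, le_div_iff₀ hpos]
  have hconv' : ∀ (s : ℝ) (z : EuclideanSpace ℝ (Fin 3)), ‖z‖ ≤ D * Real.exp (γ * s) ↔ Real.exp (-γ * s) * ‖z‖ ≤ D := by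
    intro s z
    have hpos : 0 < Real.exp (γ * s) := Real.exp_pos _
    have e : Real.exp (-γ * s) * ‖z‖ = ‖z‖ / Real.exp (γ * s) := by
      rw [show -γ * s = -(γ * s) by ring, Real.exp_neg, div_eq_inv_mul]
    rw [e, div_le_iff₀ hpos]
  have hesc' : ∃ s ∈ Icc 0 S, D ≤ Real.exp (-γ * s) * ‖ODE.evolutionMap (fun _ : ℝ => selfSimilarTransport γ 0 V) 0 s y‖ := by
    obtain ⟨s, hs, h⟩ := hesc
    exact ⟨s, hs, (hconv s _).1 h⟩
  obtain ⟨s₁, s₂, hs₁, h12, hs₂S, hstay, hexit, hentry, -⟩ := exists_crossing_times (γ := γ) hV hK hD hy hesc'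
  rw [← hΦ] at hstay hexit hentry ⊢
  -- Step 1: FTC for the physical position, `D/2 ≤ ∫_{s₁}^{s₂} e^{−γs}‖V(Ψ_s y)‖`
  have hderiv : ∀ s ∈ uIcc s₁ s₂, HasDerivAt (fun r : ℝ => Real.exp (-γ * r) • Φ r y)
      (Real.exp (-γ * s) • V (Φ s y)) s := fun s _ => by
    rw [hΦ]; exact hasDerivAt_physicalPosition (γ := γ) hV hK y s
  have hcv : Continuous fun s : ℝ => Real.exp (-γ * s) • V (Φ s y) := by
    rw [hΦ]
    exact (by fun_prop : Continuous fun s : ℝ => Real.exp (-γ * s)).smul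
      (hV.continuous.comp (continuous_flow_time (γ := γ) hV hK y))
  have hFTC := intervalIntegral.integral_eq_sub_of_hasDerivAt hderiv (hcv.intervalIntegrable s₁ s₂)
  have hdisp : D / 2 ≤ ∫ s in s₁..s₂, Real.exp (-γ * s) * ‖V (Φ s y)‖ := by
    have h1 : D / 2 ≤ ‖Real.exp (-γ * s₂) • Φ s₂ y - Real.exp (-γ * s₁) • Φ s₁ y‖ := by
      have hn : ∀ s, ‖Real.exp (-γ * s) • Φ s y‖ = Real.exp (-γ * s) * ‖Φ s y‖ := fun s => by
        rw [norm_smul, Real.norm_of_nonneg (Real.exp_pos _).le]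
      have := norm_sub_norm_le (Real.exp (-γ * s₂) • Φ s₂ y) (Real.exp (-γ * s₁) • Φ s₁ y)
      rw [hn, hn] at this
      linarith
    rw [← hFTC] at h1
    refine h1.trans ((intervalIntegral.norm_integral_le_integral_norm h12.le).trans (le_of_eq ?_))
    refine intervalIntegral.integral_congr fun s _ => ?_
    simp only [norm_smul, Real.norm_of_nonneg (Real.exp_pos _).le]
  -- Step 2: pass to `ℝ≥0∞` and Cauchy–Schwarz in time
  have hcn : Continuous fun s : ℝ => Real.exp (-γ * s) * ‖V (Φ s y)‖ := by
    rw [hΦ]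
    exact (by fun_prop : Continuous fun s : ℝ => Real.exp (-γ * s)).mul
      (hV.continuous.comp (continuous_flow_time (γ := γ) hV hK y)).norm
  have hint : IntegrableOn (fun s : ℝ => Real.exp (-γ * s) * ‖V (Φ s y)‖) (Ioc s₁ s₂) volume :=
    (hcn.continuousOn.integrableOn_compact isCompact_Icc).mono_set Ioc_subset_Icc_self
  have hD2 : ENNReal.ofReal (D / 2) ≤ ∫⁻ s in Ioc s₁ s₂, ENNReal.ofReal (Real.exp (-γ * s) * ‖V (Φ s y)‖) := by
    rw [← ofReal_integral_eq_lintegral_ofReal hint (ae_of_all _ fun s =>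
      mul_nonneg (Real.exp_pos _).le (norm_nonneg _)), ← intervalIntegral.integral_of_le h12.le]
    exact ENNReal.ofReal_le_ofReal hdisp
  -- split `e^{−γs}‖V‖ = e^{−s/2} · (e^{s/2}e^{−γs}‖V‖)` and apply Cauchy–Schwarz in time
  have hsplit : ∀ s, ENNReal.ofReal (Real.exp (-γ * s) * ‖V (Φ s y)‖) =
      ENNReal.ofReal (Real.exp (-(s / 2))) * ENNReal.ofReal (Real.exp (s / 2) * (Real.exp (-γ * s) * ‖V (Φ s y)‖)) := by
    intro s
    rw [← ENNReal.ofReal_mul (Real.exp_pos _).le]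
    congr 1
    rw [show Real.exp (-(s / 2)) * (Real.exp (s / 2) * (Real.exp (-γ * s) * ‖V (Φ s y)‖)) =
      (Real.exp (-(s / 2)) * Real.exp (s / 2)) * (Real.exp (-γ * s) * ‖V (Φ s y)‖) by ring, ← Real.exp_add]
    simp
  have hm1 : AEMeasurable (fun s : ℝ => ENNReal.ofReal (Real.exp (-(s / 2)))) (volume.restrict (Ioc s₁ s₂)) :=
    (ENNReal.measurable_ofReal.comp (by fun_prop : Measurable fun s : ℝ => Real.exp (-(s / 2)))).aemeasurable
  have hcn2 : Continuous fun s : ℝ => Real.exp (s / 2) * (Real.exp (-γ * s) * ‖V (Φ s y)‖) :=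
    (by fun_prop : Continuous fun s : ℝ => Real.exp (s / 2)).mul hcn
  have hm2 : AEMeasurable (fun s : ℝ => ENNReal.ofReal (Real.exp (s / 2) * (Real.exp (-γ * s) * ‖V (Φ s y)‖)))
      (volume.restrict (Ioc s₁ s₂)) := (ENNReal.measurable_ofReal.comp hcn2.measurable).aemeasurable
  have hCS := ENNReal.lintegral_mul_le_Lp_mul_Lq (volume.restrict (Ioc s₁ s₂)) Real.HolderConjugate.two_two hm1 hm2
  have hLHS : ∫⁻ s in Ioc s₁ s₂, ENNReal.ofReal (Real.exp (-γ * s) * ‖V (Φ s y)‖) =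
      ∫⁻ s in Ioc s₁ s₂, ((fun s : ℝ => ENNReal.ofReal (Real.exp (-(s / 2)))) *
        fun s : ℝ => ENNReal.ofReal (Real.exp (s / 2) * (Real.exp (-γ * s) * ‖V (Φ s y)‖))) s :=
    lintegral_congr fun s => by rw [Pi.mul_apply]; exact hsplit s
  have e2 : ∀ x : ℝ≥0∞, x ^ (2 : ℝ) = x ^ 2 := fun x => by exact_mod_cast ENNReal.rpow_natCast x 2
  -- the first factor is `≤ 1`
  have hF1 : (∫⁻ s in Ioc s₁ s₂, ENNReal.ofReal (Real.exp (-(s / 2))) ^ (2 : ℝ)) ^ (1 / (2 : ℝ)) ≤ 1 := by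
    have h : ∫⁻ s in Ioc s₁ s₂, ENNReal.ofReal (Real.exp (-(s / 2))) ^ (2 : ℝ) ≤ 1 := by
      calc ∫⁻ s in Ioc s₁ s₂, ENNReal.ofReal (Real.exp (-(s / 2))) ^ (2 : ℝ)
          = ∫⁻ s in Ioc s₁ s₂, ENNReal.ofReal (Real.exp (-s)) := by
            refine lintegral_congr fun s => ?_
            rw [e2, ← ENNReal.ofReal_pow (Real.exp_pos _).le, ← Real.exp_nat_mul]
            congr 1
            push_cast
            ring
        _ ≤ 1 := lintegral_exp_neg_Ioc_le_one hs₁ h12.le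
    calc (∫⁻ s in Ioc s₁ s₂, ENNReal.ofReal (Real.exp (-(s / 2))) ^ (2 : ℝ)) ^ (1 / (2 : ℝ))
        ≤ (1 : ℝ≥0∞) ^ (1 / (2 : ℝ)) := ENNReal.rpow_le_rpow h (by norm_num)
      _ = 1 := ENNReal.one_rpow _
  -- the second factor's integrand
  have hG : ∀ s, ENNReal.ofReal (Real.exp (s / 2) * (Real.exp (-γ * s) * ‖V (Φ s y)‖)) ^ (2 : ℝ) =
      ENNReal.ofReal (Real.exp ((1 - 2 * γ) * s)) * ‖V (Φ s y)‖ₑ ^ 2 := by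
    intro s
    rw [e2, ← ENNReal.ofReal_pow (by positivity),
      show (Real.exp (s / 2) * (Real.exp (-γ * s) * ‖V (Φ s y)‖)) ^ 2 =
        (Real.exp (s / 2) * Real.exp (-γ * s)) ^ 2 * ‖V (Φ s y)‖ ^ 2 by ring,
      ← Real.exp_add, ← Real.exp_nat_mul, ENNReal.ofReal_mul (Real.exp_pos _).le, ENNReal.ofReal_pow (norm_nonneg _),
      ofReal_norm]
    congr 3
    push_cast
    ring
  have hmain : ENNReal.ofReal (D / 2) ≤
      (∫⁻ s in Ioc s₁ s₂, ENNReal.ofReal (Real.exp ((1 - 2 * γ) * s)) * ‖V (Φ s y)‖ₑ ^ 2) ^ (1 / (2 : ℝ)) := by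
    have h := hD2.trans (hLHS.le.trans hCS)
    simp_rw [hG] at h
    refine h.trans ?_
    calc (∫⁻ s in Ioc s₁ s₂, ENNReal.ofReal (Real.exp (-(s / 2))) ^ (2 : ℝ)) ^ (1 / (2 : ℝ)) *
          (∫⁻ s in Ioc s₁ s₂, ENNReal.ofReal (Real.exp ((1 - 2 * γ) * s)) * ‖V (Φ s y)‖ₑ ^ 2) ^ (1 / (2 : ℝ))
        ≤ 1 * (∫⁻ s in Ioc s₁ s₂, ENNReal.ofReal (Real.exp ((1 - 2 * γ) * s)) * ‖V (Φ s y)‖ₑ ^ 2) ^ (1 / (2 : ℝ)) :=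
          mul_le_mul_left hF1 _
      _ = _ := one_mul _
  -- square
  have hsq : ENNReal.ofReal ((D / 2) ^ 2) ≤
      ∫⁻ s in Ioc s₁ s₂, ENNReal.ofReal (Real.exp ((1 - 2 * γ) * s)) * ‖V (Φ s y)‖ₑ ^ 2 := by
    have h := ENNReal.rpow_le_rpow hmain (by norm_num : (0 : ℝ) ≤ 2)
    rw [← ENNReal.rpow_mul, show (1 / (2 : ℝ)) * 2 = 1 by norm_num, ENNReal.rpow_one, e2,
      ← ENNReal.ofReal_pow (by positivity)] at h
    exact h
  -- monotonicity into the indicator integral over `[0, S]`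
  calc ENNReal.ofReal ((D / 2) ^ 2)
      ≤ ∫⁻ s in Ioc s₁ s₂, ENNReal.ofReal (Real.exp ((1 - 2 * γ) * s)) * ‖V (Φ s y)‖ₑ ^ 2 := hsq
    _ = ∫⁻ s in Ioc s₁ s₂, indicator {s' : ℝ | ∀ σ ∈ Icc 0 s', ‖Φ σ y‖ ≤ D * Real.exp (γ * σ)}
          (fun s' => ENNReal.ofReal (Real.exp ((1 - 2 * γ) * s')) * ‖V (Φ s' y)‖ₑ ^ 2) s := by
        refine setLIntegral_congr_fun measurableSet_Ioc (fun s hs => ?_)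
        rw [indicator_of_mem (show s ∈ {s' : ℝ | ∀ σ ∈ Icc 0 s', ‖Φ σ y‖ ≤ D * Real.exp (γ * σ)} from
          fun σ hσ => (hconv' σ _).2 (hstay σ ⟨hσ.1, hσ.2.trans hs.2⟩))]
    _ ≤ ∫⁻ s in Icc 0 S, indicator {s' : ℝ | ∀ σ ∈ Icc 0 s', ‖Φ σ y‖ ≤ D * Real.exp (γ * σ)}
          (fun s' => ENNReal.ofReal (Real.exp ((1 - 2 * γ) * s')) * ‖V (Φ s' y)‖ₑ ^ 2) s :=
        lintegral_mono_set fun s hs => ⟨hs₁.trans hs.1.le, hs.2.trans hs₂S⟩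

end Summit.NavierStokesRegularity.NavierStokesRegularity.Theorems.PowerGaugeEulerLiouville.Trace
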